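import Summits.Ventures.PercRepro.RLSLinearSpace

/-!
# C-025 at q = 3: the counting identities of the tail count (★★) for a linear space (night-3 g2)

N3-TAIL-LOSSY.md §6: in a linear space on `g` points, the subsets of size `≥ 6` split into those inside a line (`Σ_ℓ (2^{|ℓ|} − S(|ℓ|,5))`),
the near-pencil-shaped ones (`Σ_ℓ (g − |ℓ|)(2^{|ℓ|} − S(|ℓ|,4))`: `A ∪ {v}`, `A ⊆ ℓ`, `|A| ≥ 5`, `v ∉ ℓ`) and the WINNERS; and the near-pencil-shaped
subsets of size `≥ 5` number `Σ_ℓ (g − |ℓ|)(2^{|ℓ|} − S(|ℓ|,3))`.  This file proves those identities (`card_winners`, `card_npAll`) as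
natural-number statements over the `LinearSpace` of `RLSLinearSpace`.  No `decide`.
-/

namespace PercRepro.NightThree.LinSp

open Finset

variable {α : Type*} [DecidableEq α]

/-- `Σ_{i ∈ [m, k]} C(k, i)`: the number of subsets of a `k`-set with at least `m` elements. -/
def bigCard (k m : ℕ) : ℕ := ∑ i ∈ Ico m (k + 1), k.choose i

omit [DecidableEq α] in
/-- The subsets of `s` with at least `m` elements number `bigCard |s| m`. -/
theorem card_filter_ge (s : Finset α) (m : ℕ) :
    (s.powerset.filter (fun B => m ≤ B.card)).card = bigCard s.card m := by
  classical
  rw [powerset_card_disjiUnion, Finset.filter_disjiUnion, Finset.card_disjiUnion]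
  unfold bigCard
  have h : ∀ i ∈ range (s.card + 1), ((s.powersetCard i).filter (fun B => m ≤ B.card)).card = if m ≤ i then s.card.choose i else 0 := by
    intro i hi
    split_ifs with hmi
    · rw [Finset.filter_true_of_mem, card_powersetCard]
      intro B hB
      rw [mem_powersetCard] at hB
      omega
    · rw [Finset.filter_false_of_mem, card_empty]
      intro B hB
      rw [mem_powersetCard] at hB
      omega
  rw [Finset.sum_congr rfl h, ← Finset.sum_filter]
  congr 1
  ext i
  simp only [mem_filter, mem_range, mem_Ico]
  omega


variable {pts : Finset α} (L : LinearSpace pts)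

/-- The subsets of `pts` with at least `m` points. -/
def big (pts : Finset α) (m : ℕ) : Finset (Finset α) := pts.powerset.filter (fun B => m ≤ B.card)

/-- The subsets of size `≥ m` inside the line `ℓ`. -/
def inL (pts : Finset α) (m : ℕ) (ℓ : Finset α) : Finset (Finset α) := (big pts m).filter (fun B => B ⊆ ℓ)

/-- The near-pencil-shaped subsets of size `≥ m` on the line `ℓ`: at least 4 points on `ℓ`, exactly one off it. -/
def npL (pts : Finset α) (m : ℕ) (ℓ : Finset α) : Finset (Finset α) :=
  (big pts m).filter (fun B => 4 ≤ (B ∩ ℓ).card ∧ (B \ ℓ).card = 1)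

omit [DecidableEq α] in
/-- `|big pts m| = bigCard |pts| m`. -/
theorem card_big (pts : Finset α) (m : ℕ) : (big pts m).card = bigCard pts.card m := card_filter_ge pts m

/-- `|inL ℓ| = bigCard |ℓ| m` for a line `ℓ ⊆ pts`. -/
theorem card_inL (m : ℕ) {ℓ : Finset α} (hℓ : ℓ ⊆ pts) : (inL pts m ℓ).card = bigCard ℓ.card m := by
  rw [← card_filter_ge]
  congr 1
  ext B
  simp only [inL, big, mem_filter, mem_powerset]
  constructor
  · rintro ⟨⟨_, h⟩, h'⟩; exact ⟨h', h⟩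
  · rintro ⟨h', h⟩; exact ⟨⟨h'.trans hℓ, h⟩, h'⟩

/-- `insert v` is injective on the subsets of `ℓ` when `v ∉ ℓ`. -/
theorem insert_injOn (m : ℕ) {ℓ : Finset α} {v : α} (hv : v ∉ ℓ) :
    Set.InjOn (insert v) (↑(ℓ.powerset.filter (fun A => m ≤ A.card)) : Set (Finset α)) := by
  intro A hA A' hA' h
  simp only [coe_filter, Set.mem_setOf_eq, mem_powerset] at hA hA'
  have h1 : v ∉ A := fun hx => hv (hA.1 hx)
  have h2 : v ∉ A' := fun hx => hv (hA'.1 hx)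
  rw [← erase_insert h1, ← erase_insert h2, h]

/-- `|npL ℓ| = (g − |ℓ|) · bigCard |ℓ| (m − 1)` for a line `ℓ ⊆ pts` and `m ≥ 5`. -/
theorem card_npL (m : ℕ) (hm : 5 ≤ m) {ℓ : Finset α} (hℓ : ℓ ⊆ pts) :
    (npL pts m ℓ).card = (pts.card - ℓ.card) * bigCard ℓ.card (m - 1) := by
  have himage : npL pts m ℓ =
      (pts \ ℓ).biUnion (fun v => (ℓ.powerset.filter (fun A => m - 1 ≤ A.card)).image (insert v)) := by
    ext B
    simp only [npL, big, mem_filter, mem_powerset, mem_biUnion, mem_sdiff, mem_image]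
    constructor
    · rintro ⟨⟨hB, hm'⟩, h4, h1⟩
      obtain ⟨v, hv⟩ := Finset.card_eq_one.mp h1
      have hvB : v ∈ B ∧ v ∉ ℓ := by
        have := mem_singleton_self v
        rw [← hv, mem_sdiff] at this
        exact this
      refine ⟨v, ⟨hB hvB.1, hvB.2⟩, B ∩ ℓ, ⟨inter_subset_right, ?_⟩, ?_⟩
      · have := card_inter_add_card_sdiff B ℓ
        omega
      · ext x
        simp only [mem_insert, mem_inter]
        constructor
        · rintro (rfl | ⟨hx, _⟩)
          · exact hvB.1
          · exact hx
        · intro hx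
          by_cases hxl : x ∈ ℓ
          · exact Or.inr ⟨hx, hxl⟩
          · left
            have : x ∈ B \ ℓ := mem_sdiff.mpr ⟨hx, hxl⟩
            rw [hv, mem_singleton] at this
            exact this
    · rintro ⟨v, ⟨hv, hvl⟩, A, ⟨hA, hAm⟩, rfl⟩
      have hvA : v ∉ A := fun h => hvl (hA h)
      have hcard : (insert v A).card = A.card + 1 := card_insert_of_notMem hvA
      have hiA : insert v A ∩ ℓ = A := by
        ext x
        simp only [mem_inter, mem_insert]
        constructor
        · rintro ⟨rfl | hx, hxl⟩
          · exact absurd hxl hvl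
          · exact hx
        · intro hx
          exact ⟨Or.inr hx, hA hx⟩
      have hdA : insert v A \ ℓ = {v} := by
        ext x
        simp only [mem_sdiff, mem_insert, mem_singleton]
        constructor
        · rintro ⟨rfl | hx, hxl⟩
          · rfl
          · exact absurd (hA hx) hxl
        · rintro rfl
          exact ⟨Or.inl rfl, hvl⟩
      refine ⟨⟨?_, by rw [hcard]; omega⟩, ?_, ?_⟩
      · intro x hx
        rw [mem_insert] at hx
        rcases hx with rfl | hx
        · exact hv
        · exact hℓ (hA hx)
      · rw [hiA]; omega
      · rw [hdA, card_singleton]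
  rw [himage, card_biUnion]
  · have hc : ∀ v ∈ pts \ ℓ, ((ℓ.powerset.filter (fun A => m - 1 ≤ A.card)).image (insert v)).card = bigCard ℓ.card (m - 1) := by
      intro v hv
      rw [mem_sdiff] at hv
      rw [card_image_of_injOn (insert_injOn (m - 1) hv.2), card_filter_ge]
    rw [Finset.sum_congr rfl hc, sum_const, smul_eq_mul, card_sdiff_of_subset hℓ]
  · intro v hv v' hv' hne
    rw [Function.onFun, disjoint_left]
    intro B hB hB'
    rw [mem_image] at hB hB'
    obtain ⟨A, hA, rfl⟩ := hB
    obtain ⟨A', hA', hBB⟩ := hB'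
    rw [mem_coe, mem_sdiff] at hv hv'
    rw [mem_filter, mem_powerset] at hA hA'
    have : v ∈ insert v' A' := by rw [hBB]; exact mem_insert_self v A
    rw [mem_insert] at this
    rcases this with h | h
    · exact hne h
    · exact hv.2 (hA'.1 h)

/-- The winners: subsets of size `≥ 6` inside no line and not near-pencil-shaped. -/
def winners (L : LinearSpace pts) : Finset (Finset α) :=
  (big pts 6).filter (fun B => (∀ ℓ ∈ L.lines, ¬ B ⊆ ℓ) ∧ ∀ ℓ ∈ L.lines, ¬ (4 ≤ (B ∩ ℓ).card ∧ (B \ ℓ).card = 1))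

/-- Two distinct lines carry disjoint families of `≥ 6`-point subsets (they share at most one point). -/
theorem inL_disjoint (L : LinearSpace pts) {ℓ ℓ' : Finset α} (hℓ : ℓ ∈ L.lines) (hℓ' : ℓ' ∈ L.lines) (hne : ℓ ≠ ℓ') :
    Disjoint (inL pts 6 ℓ) (inL pts 6 ℓ') := by
  rw [disjoint_left]
  intro B hB hB'
  simp only [inL, big, mem_filter, mem_powerset] at hB hB'
  have h1 := card_inter_le_one L hℓ hℓ' hne
  have h2 : B ⊆ ℓ ∩ ℓ' := subset_inter hB.2 hB'.2
  have := card_le_card h2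
  omega

/-- The near-pencil-shaped subsets of two distinct lines are disjoint families (a line with `≥ 4` of the points and one point off it is unique). -/
theorem npL_disjoint (L : LinearSpace pts) {ℓ ℓ' : Finset α} (hℓ : ℓ ∈ L.lines) (hℓ' : ℓ' ∈ L.lines) (hne : ℓ ≠ ℓ') :
    Disjoint (npL pts 6 ℓ) (npL pts 6 ℓ') := by
  rw [disjoint_left]
  intro B hB hB'
  simp only [npL, big, mem_filter, mem_powerset] at hB hB'
  have h1 := card_inter_le_one L hℓ hℓ' hne
  -- `B ∩ ℓ ⊆ (B ∩ ℓ ∩ ℓ') ∪ (B \ ℓ')`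
  have h2 : B ∩ ℓ ⊆ (ℓ ∩ ℓ') ∪ (B \ ℓ') := by
    intro x hx
    rw [mem_inter] at hx
    rw [mem_union, mem_inter, mem_sdiff]
    by_cases hx' : x ∈ ℓ'
    · exact Or.inl ⟨hx.2, hx'⟩
    · exact Or.inr ⟨hx.1, hx'⟩
  have := card_le_card h2
  have := card_union_le (ℓ ∩ ℓ') (B \ ℓ')
  omega

/-- A subset inside a line is not near-pencil-shaped on any line. -/
theorem inL_npL_disjoint (L : LinearSpace pts) {ℓ ℓ' : Finset α} (hℓ : ℓ ∈ L.lines) (hℓ' : ℓ' ∈ L.lines) :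
    Disjoint (inL pts 6 ℓ) (npL pts 6 ℓ') := by
  rw [disjoint_left]
  intro B hB hB'
  simp only [inL, big, npL, mem_filter, mem_powerset] at hB hB'
  by_cases hne : ℓ = ℓ'
  · subst hne
    have : B \ ℓ = ∅ := sdiff_eq_empty_iff_subset.mpr hB.2
    rw [this, card_empty] at hB'
    omega
  · have h1 := card_inter_le_one L hℓ hℓ' hne
    have h2 : B ∩ ℓ' ⊆ ℓ ∩ ℓ' := inter_subset_inter hB.2 (le_refl _)
    have := card_le_card h2
    omega

/-- The partition of the subsets of size `≥ 6`: winners, inside a line, near-pencil-shaped. -/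
theorem card_big_six (L : LinearSpace pts) :
    (big pts 6).card = (winners L).card + ∑ ℓ ∈ L.lines, (inL pts 6 ℓ).card + ∑ ℓ ∈ L.lines, (npL pts 6 ℓ).card := by
  have hdecomp : big pts 6 = winners L ∪ (L.lines.biUnion (inL pts 6) ∪ L.lines.biUnion (npL pts 6)) := by
    ext B
    simp only [winners, inL, npL, mem_union, mem_filter, mem_biUnion]
    constructor
    · intro hB
      by_cases hw : (∀ ℓ ∈ L.lines, ¬ B ⊆ ℓ) ∧ ∀ ℓ ∈ L.lines, ¬ (4 ≤ (B ∩ ℓ).card ∧ (B \ ℓ).card = 1)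
      · exact Or.inl ⟨hB, hw⟩
      · right
        rw [not_and_or] at hw
        rcases hw with h | h
        · push Not at h
          obtain ⟨ℓ, hℓ, hBℓ⟩ := h
          exact Or.inl ⟨ℓ, hℓ, hB, hBℓ⟩
        · push Not at h
          obtain ⟨ℓ, hℓ, h4, h1⟩ := h
          exact Or.inr ⟨ℓ, hℓ, hB, h4, h1⟩
    · rintro (⟨hB, _⟩ | ⟨ℓ, _, hB, _⟩ | ⟨ℓ, _, hB, _⟩) <;> exact hB
  have hd1 : Disjoint (L.lines.biUnion (inL pts 6)) (L.lines.biUnion (npL pts 6)) := by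
    rw [disjoint_left]
    intro B hB hB'
    rw [mem_biUnion] at hB hB'
    obtain ⟨ℓ, hℓ, hB⟩ := hB
    obtain ⟨ℓ', hℓ', hB'⟩ := hB'
    exact disjoint_left.mp (inL_npL_disjoint L hℓ hℓ') hB hB'
  have hd2 : Disjoint (winners L) (L.lines.biUnion (inL pts 6) ∪ L.lines.biUnion (npL pts 6)) := by
    rw [disjoint_left]
    intro B hB hB'
    simp only [winners, mem_filter] at hB
    rw [mem_union, mem_biUnion, mem_biUnion] at hB'
    rcases hB' with ⟨ℓ, hℓ, h⟩ | ⟨ℓ, hℓ, h⟩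
    · simp only [inL, mem_filter] at h
      exact hB.2.1 ℓ hℓ h.2
    · simp only [npL, mem_filter] at h
      exact hB.2.2 ℓ hℓ h.2
  have hpd1 : (↑L.lines : Set (Finset α)).PairwiseDisjoint (inL pts 6) := by
    intro ℓ hℓ ℓ' hℓ' hne
    exact inL_disjoint L (mem_coe.mp hℓ) (mem_coe.mp hℓ') hne
  have hpd2 : (↑L.lines : Set (Finset α)).PairwiseDisjoint (npL pts 6) := by
    intro ℓ hℓ ℓ' hℓ' hne
    exact npL_disjoint L (mem_coe.mp hℓ) (mem_coe.mp hℓ') hne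
  rw [hdecomp, card_union_of_disjoint hd2, card_union_of_disjoint hd1, card_biUnion hpd1, card_biUnion hpd2]
  ring

/-- The near-pencil-shaped subsets of size `≥ 5` are the disjoint union over the lines. -/
theorem card_npAll (L : LinearSpace pts) :
    ((big pts 5).filter (fun B => ∃ ℓ ∈ L.lines, 4 ≤ (B ∩ ℓ).card ∧ (B \ ℓ).card = 1)).card =
      ∑ ℓ ∈ L.lines, (npL pts 5 ℓ).card := by
  have h : (big pts 5).filter (fun B => ∃ ℓ ∈ L.lines, 4 ≤ (B ∩ ℓ).card ∧ (B \ ℓ).card = 1) = L.lines.biUnion (npL pts 5) := by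
    ext B
    simp only [npL, mem_filter, mem_biUnion]
    constructor
    · rintro ⟨hB, ℓ, hℓ, h⟩; exact ⟨ℓ, hℓ, hB, h⟩
    · rintro ⟨ℓ, hℓ, hB, h⟩; exact ⟨hB, ℓ, hℓ, h⟩
  rw [h, card_biUnion]
  intro ℓ hℓ ℓ' hℓ' hne
  rw [Function.onFun, disjoint_left]
  intro B hB hB'
  simp only [npL, big, mem_filter, mem_powerset] at hB hB'
  have h1 := card_inter_le_one L (mem_coe.mp hℓ) (mem_coe.mp hℓ') hne
  have h2 : B ∩ ℓ ⊆ (ℓ ∩ ℓ') ∪ (B \ ℓ') := by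
    intro x hx
    rw [mem_inter] at hx
    rw [mem_union, mem_inter, mem_sdiff]
    by_cases hx' : x ∈ ℓ'
    · exact Or.inl ⟨hx.2, hx'⟩
    · exact Or.inr ⟨hx.1, hx'⟩
  have := card_le_card h2
  have := card_union_le (ℓ ∩ ℓ') (B \ ℓ')
  omega

end PercRepro.NightThree.LinSp
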